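import Summits.QuantumFields.YangMills.Theorems.BalabanUVNodesN15KingModelPotentialNE2

/-!
# N15 (NE2⁺), King-model rung, part 20: COHERENCE IS NOT IDLE — the (H3) letter of the first variation FAILS on the size-only sort

Cell `pub-ymgap-dag-n15-d` (R134 acceleration DAG, node N15 = NE2, strategy s3 KING-MODEL RUNG), part 20.  Parts 8b ∕ 8c
(`…PotentialLetters`, `…PotentialNE2`) derived King's two-spacing letter (H3) `EffectiveOperatorSupRate (potTower v) ε r` for the FIRST
VARIATION `E_k(v)(b,b′) = N^{−(d+1)}Σ_x ℋ_k(x,b)v_{L^k}(x)ℋ_k(x,b′)` of King's effective Laplacian along a potential tower `v`, under TWO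
letters: size (`sup|v_N| ≤ w₀`, the (3.35) slot of the sort `potBg`) AND one-step coherence (`sup|v_{L·L^k}(x′) − v_{L^k}(x)| ≤ ν₀s^k`, the
(3.36) slot).  g6's HANDOFF asked for the tightness theorem «`_false_without_coherence` … needs a uniform LOWER bound on the Gram entries
`(ℋᵀℋ)(b,b)` — not in the tree».  THIS FILE proves that lower bound and the tightness theorem:

* §1 a STRICT zone bound for King's symbol (4.5): `Δ^{(k)}(p′) ≤ (a⁻¹ + S₀)⁻¹ < a`, `S₀ = (4∕π²)^d ∕ (dπ² + m²)` (the `l = 0` alias term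
  alone: `|u(p′)|² ≥ (4∕π²)^d` on the Brillouin zone, `Δ^η(p′) ≤ dπ² + m²`), uniformly in `N = L^k` and the torus (`composedInvResc_ge_zone`,
  `DeltaEff_le_zone`);
* §2 hence, by (4.35) (`effLaplacian_form_DeltaEff`) and Plancherel, `⟨φ, Δ^{(k)}φ⟩ ≤ (a⁻¹ + S₀)⁻¹‖φ‖²` and `Δ^{(k)}(b,b) ≤ (a⁻¹ + S₀)⁻¹`
  (`effLaplacian_form_le_zone`, `effLaplacian_diag_le_zone`);
* §3 the BLOCK MEAN of the minimiser: `Q_kℋ_kφ = φ − a_k⁻¹Δ^{(k)}φ` (`Qmat_mulVec_minimiser`, pure algebra of (2.13)–(2.14)), so the mean of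
  `ℋ_k(·, b)` over the block `B(b)` is `1 − a_k⁻¹Δ^{(k)}(b,b) ≥ q := a_minS₀∕(1 + a_minS₀) > 0` (`blockMean_kingH_ge`);
* §4 THE GRAM LOWER BOUND (Cauchy–Schwarz on the block): `N^{−(d+1)}Σ_x ℋ_k(x,b)² ≥ q²` uniformly in `k ≥ 1`, the volume and the torus
  (`gram_kingH_diag_ge`), and `E_k(c·1)(b,b) ≥ c·q²` for every constant potential `c ≥ 0` (`potLevel_const_diag_le` is NOT claimed — only `_ge`);
* §5 ★★ `potTower_supRate_false_without_coherence`: for EVERY `w₀ > 0`, `ε`, `0 ≤ r < 1` there is a size-regular tower (`sup|v_N| ≤ w₀`;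
  namely `v_N = w₀·[N = L^{j+1}]`, `j` large) with `¬ EffectiveOperatorSupRate (potTower L U a m² v) ε r`; ★ `potBg_reg336_not_idle`: the same
  read on part 8c's sort — inside EVERY (3.35)-window `(c₃₅, α₀)` of `potBg` there is a configuration violating the (H3) letter, so the (3.36)
  hypothesis of `ne2PlusUnit_kingV` ∕ `potTower_letters_kingU` cannot be dropped.

HONEST SCOPE.  King's A = 0 scalar model; ANY unit torus `Π ℤ∕U_μ` (no King-admissibility needed: §§1–4 are symbol facts), `L ≥ 2`, `a, m² > 0`;
scalar potentials (NOT gauge fields); a NEGATIVE ∕ tightness statement about THIS LINEAGE's letters ((H3) of `Spine.NE2KingTransplant` for the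
first-variation tower), not about any printed proposition and not about Bałaban's `Δ^{(k)}(U)`; count-neutral (`--supports`), not a discharge
of N15, nothing in `YMDAG.*` touched; THEOREMS ONLY (0 `def`, 0 `sorry`), standard axioms.

References: C. King, Commun. Math. Phys. 102 (1986) 649–677: (2.13)–(2.15) p.653 (the minimiser `ℋ_k = a_kG_kQ_k^*`), (4.3)–(4.5) p.670
(the symbol and its alias sum), (4.35) p.674 (kernel from symbol) (bib key `King1986`); [B9] = Bałaban, Commun. Math. Phys. 102 (1985)
385–462, (3.35)–(3.36) p.396 (the two regularity slots: typing template) (bib key `Balaban1985BackgroundPropagators`).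
-/

noncomputable section
open scoped BigOperators Matrix
open Finset

namespace Summit.QuantumFields.YangMills.BalabanUVNodes.N15.KingModel

open Literature.MathematicalPhysics.QuantumFieldTheory.Balaban1983to89 hiding blockOf
open Literature.MathematicalPhysics.QuantumFieldTheory.Balaban1983to89.B5Prop11Plancherel (Tor fine sOf abs_sOf_le)
open Literature.MathematicalPhysics.QuantumFieldTheory.King1986 (aK aK_pos DeltaEff composedInvResc shiftr_zero)
open Literature.MathematicalPhysics.QuantumFieldTheory.King1986.Torus
open Summit.QuantumFields.BalabanUV.T4Continuum.NE2KingTransplant (EffectiveOperatorSupRate)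
open Summit.QuantumFields.YangMills.BalabanUVNodes.N15KingModelRung (kingH)
open Real

variable {d : ℕ}

/-! ## §1 A strict zone bound for King's symbol (4.5) -/

section Symbol

variable {dd : ℕ}

/-- THE `l = 0` ALIAS TERM ALONE: on the Brillouin zone `|p′_μ| ≤ π`, `c + (4∕π²)^d∕(dπ² + M) ≤ c + Σ_l |u(p′+l)|²Δ^η(p′+l)⁻¹` (`N ≥ 1`, `M > 0`;
`|u(p′)|² ≥ (4∕π²)^d`, `Δ^η(p′) = Σ_μ 4N²sin²(p′_μ∕2N) + M ≤ dπ² + M`). [cite: King1986, (4.3)–(4.5) p.670 (the alias sum)] -/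
theorem composedInvResc_ge_zone (c : ℝ) {N : ℕ} (hN : 1 ≤ N) {Mt : ℝ} (hMt : 0 < Mt) {y : Fin dd → ℝ} (hy : ∀ μ, |y μ| ≤ π) :
    c + (4 / π ^ 2) ^ dd / ((dd : ℝ) * π ^ 2 + Mt) ≤ composedInvResc c N Mt y := by
  haveI : NeZero N := ⟨by omega⟩
  unfold composedInvResc
  suffices hS : (4 / π ^ 2) ^ dd / ((dd : ℝ) * π ^ 2 + Mt)
      ≤ ∑ m : Fin dd → Fin N, B4Strip.Ur N m y * (B4Strip.DeltaXir N Mt (B4Strip.shiftr N m y))⁻¹ by linarith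
  have hterm : ∀ m : Fin dd → Fin N, 0 ≤ B4Strip.Ur N m y * (B4Strip.DeltaXir N Mt (B4Strip.shiftr N m y))⁻¹ := fun m =>
    mul_nonneg (B4Strip.Ur_nonneg N m y) (inv_nonneg.mpr (B4Strip.DeltaXir_nonneg N Mt hMt.le _))
  have hD : B4Strip.DeltaXir N Mt y ≤ (dd : ℝ) * π ^ 2 + Mt := by
    unfold B4Strip.DeltaXir
    have h1 : ∑ μ, B4Strip.Sxir N (y μ) ≤ ∑ _μ : Fin dd, π ^ 2 := Finset.sum_le_sum fun μ _ =>
      (B4Strip.Sxir_le N (y μ)).trans (by rw [← sq_abs]; exact pow_le_pow_left₀ (abs_nonneg _) (hy μ) 2)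
    rw [Finset.sum_const, Finset.card_univ, Fintype.card_fin, nsmul_eq_mul] at h1
    linarith
  have hDpos : 0 < B4Strip.DeltaXir N Mt y := by
    have h0 := B4Strip.DeltaXir_nonneg N 0 le_rfl y
    unfold B4Strip.DeltaXir at h0 ⊢
    linarith
  have h0 : (4 / π ^ 2) ^ dd / ((dd : ℝ) * π ^ 2 + Mt)
      ≤ B4Strip.Ur N (fun _ => (0 : Fin N)) y * (B4Strip.DeltaXir N Mt (B4Strip.shiftr N (fun _ => (0 : Fin N)) y))⁻¹ := by
    rw [shiftr_zero, div_eq_mul_inv]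
    exact mul_le_mul (B4Strip.Ur_zero_ge N hN y hy) (inv_anti₀ hDpos hD) (inv_nonneg.mpr (by positivity))
      (B4Strip.Ur_nonneg N _ y)
  exact h0.trans (Finset.single_le_sum (fun m _ => hterm m) (Finset.mem_univ _))

/-- **KING'S SYMBOL IS STRICTLY BELOW `a`, UNIFORMLY**: `Δ^{(k)}(p′) ≤ (a⁻¹ + (4∕π²)^d∕(dπ² + M))⁻¹` on the Brillouin zone (`a, M > 0`, `N ≥ 1`)
— the companion of the tree's `DeltaEff_le` (`≤ a`) and `DeltaEff_ge_mass`. [cite: King1986, (4.5) p.670] -/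
theorem DeltaEff_le_zone {a : ℝ} (ha : 0 < a) {N : ℕ} (hN : 1 ≤ N) {Mt : ℝ} (hMt : 0 < Mt) {y : Fin dd → ℝ}
    (hy : ∀ μ, |y μ| ≤ π) : DeltaEff a N Mt y ≤ (a⁻¹ + (4 / π ^ 2) ^ dd / ((dd : ℝ) * π ^ 2 + Mt))⁻¹ := by
  unfold DeltaEff
  exact inv_anti₀ (by positivity) (composedInvResc_ge_zone a⁻¹ hN hMt hy)

end Symbol

/-! ## §2 The effective Laplacian's form and diagonal are strictly below `a`, uniformly -/

section Form

variable (N : ℕ) [NeZero N] (U : Fin (d + 1) → ℕ) [∀ μ, NeZero (U μ)]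

/-- **`⟨φ, Δ^{(k)}φ⟩ ≤ (a⁻¹ + S₀)⁻¹‖φ‖²`**, `S₀ = (4∕π²)^{d+1}∕((d+1)π² + m²)`, on EVERY unit torus, uniformly in `N ≥ 1` ((4.35) + Plancherel, as
the tree's `effLaplacian_coercive` with the inequality reversed). [cite: King1986, (4.5) p.670, (4.35) p.674] -/
theorem effLaplacian_form_le_zone (hN1 : 1 ≤ N) {a m2 : ℝ} (ha : 0 < a) (hm : 0 < m2) (φ : Tor U → ℝ) :
    φ ⬝ᵥ (effLaplacian N U a ((N : ℝ) ^ 2) m2 *ᵥ φ)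
      ≤ (a⁻¹ + (4 / π ^ 2) ^ (d + 1) / (((d + 1 : ℕ) : ℝ) * π ^ 2 + m2))⁻¹ * (φ ⬝ᵥ φ) := by
  set T : ℝ := (a⁻¹ + (4 / π ^ 2) ^ (d + 1) / (((d + 1 : ℕ) : ℝ) * π ^ 2 + m2))⁻¹ with hT
  have hcard : (0 : ℝ) < Fintype.card (Tor U) := by exact_mod_cast Fintype.card_pos
  have hform := effLaplacian_form_DeltaEff N U hN1 ha hm φ
  have hpar := parseval_dot U φ
  have hsum : ∑ q : Tor U, DeltaEff a N m2 (sOf U q) * ‖ft U φ q‖ ^ 2 ≤ T * ∑ q : Tor U, ‖ft U φ q‖ ^ 2 := by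
    rw [Finset.mul_sum]
    exact Finset.sum_le_sum fun q _ => mul_le_mul_of_nonneg_right (DeltaEff_le_zone ha hN1 hm (abs_sOf_le U q)) (sq_nonneg _)
  rw [← hpar, ← hform] at hsum
  have h2 : (Fintype.card (Tor U) : ℝ) * (φ ⬝ᵥ (effLaplacian N U a ((N : ℝ) ^ 2) m2 *ᵥ φ))
      ≤ (Fintype.card (Tor U) : ℝ) * (T * (φ ⬝ᵥ φ)) := by linarith
  exact le_of_mul_le_mul_left h2 hcard

/-- **`Δ^{(k)}(b,b) ≤ (a⁻¹ + S₀)⁻¹`** at every unit site, uniformly in `N ≥ 1` and the torus. [cite: King1986, (4.5) p.670, (4.35) p.674] -/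
theorem effLaplacian_diag_le_zone (hN1 : 1 ≤ N) {a m2 : ℝ} (ha : 0 < a) (hm : 0 < m2) (b : Tor U) :
    effLaplacian N U a ((N : ℝ) ^ 2) m2 b b ≤ (a⁻¹ + (4 / π ^ 2) ^ (d + 1) / (((d + 1 : ℕ) : ℝ) * π ^ 2 + m2))⁻¹ := by
  have h := effLaplacian_form_le_zone N U hN1 ha hm (Pi.single b 1)
  simp only [Matrix.mulVec_single_one, single_dotProduct, one_mul, Matrix.col_apply, Pi.single_eq_same, mul_one] at h
  exact h

end Form

/-! ## §3 The block mean of the minimiser: `Q_kℋ_k = 1 − a_k⁻¹Δ^{(k)}` and its uniform lower bound -/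

section BlockMean

variable (N : ℕ) [NeZero N] (U : Fin (d + 1) → ℕ) [∀ μ, NeZero (U μ)]

/-- The block mean of a fine field is the normalised sum over the offsets of the block. [cite: King1986, (2.10)–(2.11) p.653 (the block averaging operators `Q_k` over the blocks `B^k(y)`)] -/
theorem Qmat_mulVec_eq_blockSum (f : Tor (fine N U) → ℝ) (b : Tor U) :
    (Qmat N U *ᵥ f) b = (((N : ℕ) : ℝ) ^ (d + 1))⁻¹ * ∑ j : Fin (d + 1) → Fin N, f (site N U b j) := by
  show ∑ x, Qmat N U b x * f x = _
  simp only [Qmat]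
  rw [sum_fine_eq_sum_blocks N U]
  simp only [blockOf_site]
  rw [Finset.sum_eq_single b (fun z _ hz => by simp [hz]) (fun h => absurd (Finset.mem_univ b) h)]
  simp only [if_true]
  rw [Finset.mul_sum]

/-- **`Q_kℋ_kφ = φ − a_k⁻¹Δ^{(k)}φ`**: the block mean of King's minimiser (`ℋ = aN^{d}A₀⁻¹Qᵀ`, `Δ_eff = a − a²N^{d}QA₀⁻¹Qᵀ`; pure algebra,
`a ≠ 0`). [cite: King1986, (2.13)–(2.14) p.653] -/
theorem Qmat_mulVec_minimiser {a : ℝ} (ha : a ≠ 0) (c m2 : ℝ) (φ : Tor U → ℝ) :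
    Qmat N U *ᵥ minimiser N U a c m2 φ = φ - a⁻¹ • (effLaplacian N U a c m2 *ᵥ φ) := by
  have hQ : Qmat N U *ᵥ minimiser N U a c m2 φ
      = (a * (N : ℝ) ^ (d + 1)) • ((Qmat N U * (fineOp N U a c m2)⁻¹ * (Qmat N U)ᵀ) *ᵥ φ) := by
    show Qmat N U *ᵥ ((a * (N : ℝ) ^ (d + 1)) • ((fineOp N U a c m2)⁻¹ *ᵥ ((Qmat N U)ᵀ *ᵥ φ))) = _
    rw [Matrix.mulVec_smul, ← Matrix.mulVec_mulVec, ← Matrix.mulVec_mulVec]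
  have hΔ : effLaplacian N U a c m2 *ᵥ φ
      = a • φ - (a ^ 2 * (N : ℝ) ^ (d + 1)) • ((Qmat N U * (fineOp N U a c m2)⁻¹ * (Qmat N U)ᵀ) *ᵥ φ) := by
    rw [effLaplacian, Matrix.sub_mulVec, Matrix.smul_mulVec, Matrix.one_mulVec, Matrix.smul_mulVec]
  rw [hQ, hΔ, smul_sub, smul_smul, smul_smul, inv_mul_cancel₀ ha, one_smul, sub_sub_cancel]
  congr 1
  field_simp

/-- The block mean of `ℋ_k(·, b)` over its own block: `N^{−(d+1)}Σ_{x ∈ B(b)} ℋ_k(x,b) = 1 − a_k⁻¹Δ^{(k)}(b,b)` (`a_k ≠ 0`).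
[cite: King1986, (2.13)–(2.14) p.653] -/
theorem blockMean_kingH_eq (L : ℕ) [NeZero L] (a m2 : ℝ) {k : ℕ} (hak : aK a L k ≠ 0) (b : Tor U) :
    (((N : ℕ) : ℝ) ^ (d + 1))⁻¹ * ∑ j : Fin (d + 1) → Fin N, kingH L N U a m2 k b (site N U b j)
      = 1 - (aK a L k)⁻¹ * effLaplacian N U (aK a L k) (((N : ℕ) : ℝ) ^ 2) m2 b b := by
  have h := congrFun (Qmat_mulVec_minimiser N U hak (((N : ℕ) : ℝ) ^ 2) m2 (Pi.single b 1)) b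
  rw [Qmat_mulVec_eq_blockSum] at h
  simp only [Pi.sub_apply, Pi.smul_apply, Matrix.mulVec_single_one, Matrix.col_apply, Pi.single_eq_same, smul_eq_mul] at h
  exact h

/-- **THE BLOCK MEAN OF THE MINIMISER IS BOUNDED BELOW, UNIFORMLY** (`L ≥ 2`, `a, m² > 0`, `k ≥ 1`, `N = L^k`; EVERY unit torus):
`N^{−(d+1)}Σ_{x ∈ B(b)} ℋ_k(x,b) ≥ q := a_minS₀∕(1 + a_minS₀)`, `S₀ = (4∕π²)^{d+1}∕((d+1)π² + m²)`, `a_min = a(1 − L⁻²) ≤ a_k`.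
[cite: King1986, (2.13)–(2.14) p.653, (4.5) p.670] -/
theorem blockMean_kingH_ge (L : ℕ) [NeZero L] (hL : 2 ≤ L) {a m2 : ℝ} (ha : 0 < a) (hm : 0 < m2) {k : ℕ} (hk : 1 ≤ k)
    (hN : N = L ^ k) (b : Tor U) :
    aminL a L * ((4 / π ^ 2) ^ (d + 1) / (((d + 1 : ℕ) : ℝ) * π ^ 2 + m2))
        / (1 + aminL a L * ((4 / π ^ 2) ^ (d + 1) / (((d + 1 : ℕ) : ℝ) * π ^ 2 + m2)))
      ≤ (((N : ℕ) : ℝ) ^ (d + 1))⁻¹ * ∑ j : Fin (d + 1) → Fin N, kingH L N U a m2 k b (site N U b j) := by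
  set S₀ : ℝ := (4 / π ^ 2) ^ (d + 1) / (((d + 1 : ℕ) : ℝ) * π ^ 2 + m2) with hS₀def
  have hS₀ : 0 < S₀ := by positivity
  have hLr : (1 : ℝ) < L := by exact_mod_cast (show 1 < L by omega)
  have hak : 0 < aK a L k := aK_pos ha hLr hk
  have hamin : 0 < aminL a L := aminL_pos ha hL
  have hamk : aminL a L ≤ aK a L k := (aminL_le_aK ha hL hk).1
  have hN1 : 1 ≤ N := by rw [hN]; exact Nat.one_le_pow _ _ (by omega)
  rw [blockMean_kingH_eq N U L a m2 hak.ne' b]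
  have hΔ := effLaplacian_diag_le_zone N U hN1 hak hm b
  have e1 : (aK a L k)⁻¹ * ((aK a L k)⁻¹ + S₀)⁻¹ = (1 + aK a L k * S₀)⁻¹ := by
    rw [← mul_inv]
    congr 1
    field_simp
  have h1 : 1 - (1 + aK a L k * S₀)⁻¹ ≤ 1 - (aK a L k)⁻¹ * effLaplacian N U (aK a L k) (((N : ℕ) : ℝ) ^ 2) m2 b b := by
    rw [← e1]
    have := mul_le_mul_of_nonneg_left hΔ (inv_nonneg.mpr hak.le)
    linarith
  have h2 : 1 - (1 + aK a L k * S₀)⁻¹ = aK a L k * S₀ / (1 + aK a L k * S₀) := by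
    field_simp
    ring
  have h3 : aminL a L * S₀ / (1 + aminL a L * S₀) ≤ aK a L k * S₀ / (1 + aK a L k * S₀) := by
    rw [div_le_div_iff₀ (by positivity) (by positivity)]
    nlinarith [mul_le_mul_of_nonneg_right hamk hS₀.le]
  linarith

end BlockMean

/-! ## §4 The Gram lower bound and the first variation at a constant potential -/

section Gram

variable (L : ℕ) [NeZero L]

/-- **THE GRAM DIAGONAL OF KING'S MINIMISER IS BOUNDED BELOW, UNIFORMLY** (`L ≥ 2`, `a, m² > 0`): there is `q₀ > 0` (namely `q²` of
`blockMean_kingH_ge`) with `N^{−(d+1)}Σ_x ℋ_k(x,b)² ≥ q₀` for every unit torus, every `k ≥ 1` (`N = L^k`) and every unit site `b` — Cauchy–Schwarz on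
the block `B(b)` applied to the block-mean bound. [cite: King1986, (2.13)–(2.14) p.653, (4.5) p.670] -/
theorem gram_kingH_diag_ge (hL : 2 ≤ L) {a m2 : ℝ} (ha : 0 < a) (hm : 0 < m2) :
    ∃ q₀ : ℝ, 0 < q₀ ∧ ∀ (U : Fin (d + 1) → ℕ) [∀ μ, NeZero (U μ)] (k : ℕ), 1 ≤ k → ∀ (N : ℕ) [NeZero N], N = L ^ k →
      ∀ b : Tor U, q₀ ≤ (((N : ℕ) : ℝ) ^ (d + 1))⁻¹ * ∑ x, kingH L N U a m2 k b x ^ 2 := by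
  set S₀ : ℝ := (4 / π ^ 2) ^ (d + 1) / (((d + 1 : ℕ) : ℝ) * π ^ 2 + m2) with hS₀def
  have hamin : 0 < aminL a L := aminL_pos ha hL
  set q : ℝ := aminL a L * S₀ / (1 + aminL a L * S₀) with hqdef
  have hq : 0 < q := by positivity
  refine ⟨q ^ 2, by positivity, fun U _ k hk N _ hN b => ?_⟩
  set H : Tor (fine N U) → ℝ := fun x => kingH L N U a m2 k b x with hHdef
  set D : ℝ := ((N : ℕ) : ℝ) ^ (d + 1) with hDdef
  have hD : 0 < D := pow_pos (Nat.cast_pos.mpr (Nat.pos_of_ne_zero (NeZero.ne N))) _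
  have hmean : q ≤ D⁻¹ * ∑ j : Fin (d + 1) → Fin N, H (site N U b j) := blockMean_kingH_ge N U L hL ha hm hk hN b
  have hA : D * q ≤ ∑ j : Fin (d + 1) → Fin N, H (site N U b j) := by rwa [le_inv_mul_iff₀ hD] at hmean
  have hA2 : (D * q) ^ 2 ≤ (∑ j : Fin (d + 1) → Fin N, H (site N U b j)) ^ 2 := pow_le_pow_left₀ (by positivity) hA 2
  have hcs : (∑ j : Fin (d + 1) → Fin N, H (site N U b j)) ^ 2 ≤ D * ∑ j : Fin (d + 1) → Fin N, H (site N U b j) ^ 2 := by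
    have h := sq_sum_le_card_mul_sum_sq (s := (Finset.univ : Finset (Fin (d + 1) → Fin N))) (f := fun j => H (site N U b j))
    rwa [Finset.card_univ, card_offsets N] at h
  have hsub : ∑ j : Fin (d + 1) → Fin N, H (site N U b j) ^ 2 ≤ ∑ x, H x ^ 2 := by
    rw [sum_fine_eq_sum_blocks N U (fun x => H x ^ 2)]
    exact Finset.single_le_sum (f := fun z : Tor U => ∑ j : Fin (d + 1) → Fin N, H (site N U z j) ^ 2)
      (fun z _ => sum_nonneg fun j _ => sq_nonneg _) (Finset.mem_univ b)
  show q ^ 2 ≤ D⁻¹ * ∑ x, H x ^ 2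
  rw [le_inv_mul_iff₀ hD]
  have h1 : D * (D * q ^ 2) ≤ D * ∑ x, H x ^ 2 :=
    calc D * (D * q ^ 2) = (D * q) ^ 2 := by ring
      _ ≤ (∑ j : Fin (d + 1) → Fin N, H (site N U b j)) ^ 2 := hA2
      _ ≤ D * ∑ j : Fin (d + 1) → Fin N, H (site N U b j) ^ 2 := hcs
      _ ≤ D * ∑ x, H x ^ 2 := mul_le_mul_of_nonneg_left hsub hD.le
  exact le_of_mul_le_mul_left h1 hD

/-- **THE FIRST VARIATION AT A CONSTANT POTENTIAL DOES NOT DECAY IN `k`**: with `q₀` of `gram_kingH_diag_ge`, for every constant potential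
`c ≥ 0`, `E_k(c·1)(b,b) = c·N^{−(d+1)}Σ_x ℋ_k(x,b)² ≥ c·q₀`, uniformly in `k ≥ 1`, the volume and the torus. [cite: King1986, (2.13)–(2.14) p.653, (4.5) p.670] -/
theorem potLevel_const_diag_ge (hL : 2 ≤ L) {a m2 : ℝ} (ha : 0 < a) (hm : 0 < m2) :
    ∃ q₀ : ℝ, 0 < q₀ ∧ ∀ (U : Fin (d + 1) → ℕ) [∀ μ, NeZero (U μ)] (k : ℕ), 1 ≤ k → ∀ (N : ℕ) [NeZero N], N = L ^ k →
      ∀ (c : ℝ), 0 ≤ c → ∀ b : Tor U, c * q₀ ≤ potLevel L U a m2 N k (fun _ => c) b b := by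
  obtain ⟨q₀, hq₀, H⟩ := gram_kingH_diag_ge (d := d) L hL ha hm
  refine ⟨q₀, hq₀, fun U _ k hk N _ hN c hc b => ?_⟩
  have h := H U k hk N hN b
  have e : potLevel L U a m2 N k (fun _ => c) b b = c * ((((N : ℕ) : ℝ) ^ (d + 1))⁻¹ * ∑ x, kingH L N U a m2 k b x ^ 2) := by
    simp only [potLevel, Finset.mul_sum]
    exact Finset.sum_congr rfl fun x _ => by ring
  rw [e]
  exact mul_le_mul_of_nonneg_left h hc

end Gram

/-! ## §5 Coherence is not idle: the (H3) letter fails on the size-only sort -/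

section Tight

variable (L : ℕ) [NeZero L]

/-- **THE TWO-SPACING LETTER OF THE FIRST VARIATION FAILS WITHOUT COHERENCE** (`L ≥ 2`, `a, m² > 0`, ANY unit torus): for every size
`w₀ > 0`, every `ε` and every rate `0 ≤ r < 1` there is a potential tower `v` with `sup|v_N| ≤ w₀` — the tower `v_N = w₀·[N = L^{j+1}]`, `j ≥ 1`
large — such that `¬ EffectiveOperatorSupRate (potTower L U a m² v) ε r`: the level-`j` step of the first-variation tower at `(b,b)` is
`E_{j+1}(w₀·1)(b,b) − 0 ≥ w₀q₀` (`potLevel_const_diag_ge`), which beats `εr^j` for `j` large.  So part 8b's `potTower_letters_kingU` ∕ part 8c's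
`ne2PlusUnit_kingV` genuinely use their coherence hypothesis.  HONEST SCOPE: module docstring. [cite: King1986, (2.13)–(2.14) p.653, (4.5) p.670 (A = 0 model; the statement negated is this lineage's letter, not a printed one)] -/
theorem potTower_supRate_false_without_coherence (hL : 2 ≤ L) {a m2 : ℝ} (ha : 0 < a) (hm : 0 < m2)
    (U : Fin (d + 1) → ℕ) [∀ μ, NeZero (U μ)] {w₀ : ℝ} (hw₀ : 0 < w₀) (ε : ℝ) {r : ℝ} (hr0 : 0 ≤ r) (hr1 : r < 1) :
    ∃ v : ∀ N : ℕ, Tor (fine N U) → ℝ, (∀ (N : ℕ) (x : Tor (fine N U)), |v N x| ≤ w₀) ∧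
      ¬ EffectiveOperatorSupRate (potTower L U a m2 v) ε r := by
  classical
  obtain ⟨q₀, hq₀, Hq⟩ := potLevel_const_diag_ge (d := d) L hL ha hm
  -- a level `j ≥ 1` at which `ε r^j < w₀ q₀`
  have hε' : 0 < max ε 1 := lt_of_lt_of_le one_pos (le_max_right _ _)
  obtain ⟨n, hn⟩ := exists_pow_lt_of_lt_one (show 0 < w₀ * q₀ / max ε 1 by positivity) hr1
  set j : ℕ := n + 1 with hjdef
  have hj1 : 1 ≤ j := by omega
  have hrj : r ^ j ≤ r ^ n := by
    rw [hjdef, pow_succ]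
    exact mul_le_of_le_one_right (pow_nonneg hr0 n) hr1.le
  have hsmall : ε * r ^ j < w₀ * q₀ := by
    have h1 : ε * r ^ j ≤ max ε 1 * r ^ j := mul_le_mul_of_nonneg_right (le_max_left _ _) (pow_nonneg hr0 j)
    have h2 : max ε 1 * r ^ j ≤ max ε 1 * r ^ n := mul_le_mul_of_nonneg_left hrj hε'.le
    have h3 : max ε 1 * r ^ n < max ε 1 * (w₀ * q₀ / max ε 1) := mul_lt_mul_of_pos_left hn hε'
    have h4 : max ε 1 * (w₀ * q₀ / max ε 1) = w₀ * q₀ := by field_simp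
    linarith
  -- the witness tower: `w₀` at the fine count `L^{j+1}`, zero elsewhere
  refine ⟨fun N _ => if N = L ^ (j + 1) then w₀ else 0, fun N x => ?_, fun H => ?_⟩
  · show |(if N = L ^ (j + 1) then w₀ else (0 : ℝ))| ≤ w₀
    by_cases h : N = L ^ (j + 1)
    · rw [if_pos h, abs_of_pos hw₀]
    · rw [if_neg h, abs_zero]; exact hw₀.le
  · have hLne : L ^ j ≠ L ^ (j + 1) := by
      have : L ^ j < L ^ (j + 1) := Nat.pow_lt_pow_right (by omega) (by omega)
      omega
    have b : Tor U := fun _ => 0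
    have hstep := H j b b
    rw [Matrix.sub_apply, potTower_of_one_le _ (by omega : 1 ≤ j + 1), potTower_of_one_le _ hj1] at hstep
    have hup : potLevel L U a m2 (L ^ (j + 1)) (j + 1) (fun x : Tor (fine (L ^ (j + 1)) U) => if L ^ (j + 1) = L ^ (j + 1) then w₀ else 0) b b
        = potLevel L U a m2 (L ^ (j + 1)) (j + 1) (fun _ => w₀) b b := by
      simp only [if_true]
    have hdown : potLevel L U a m2 (L ^ j) j (fun x : Tor (fine (L ^ j) U) => if L ^ j = L ^ (j + 1) then w₀ else 0) b b = 0 := by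
      simp only [if_neg hLne, potLevel, mul_zero, zero_mul, sum_const_zero]
    rw [hup, hdown, sub_zero] at hstep
    have hlow := Hq U (j + 1) (by omega) (L ^ (j + 1)) rfl w₀ hw₀.le b
    have habs : potLevel L U a m2 (L ^ (j + 1)) (j + 1) (fun _ => w₀) b b ≤ ε * r ^ j := (le_abs_self _).trans hstep
    linarith

/-- **ON PART 8c's SORT THE (3.36) SLOT IS NOT IDLE**: for every `c₃₅, α₀ > 0`, every `ε` and every `0 ≤ r < 1` there is a configuration
`v` of `potBg` which IS (3.35)-regular at `(c₃₅, α₀)` (size `≤ c₃₅α₀`) and for which the (H3) letter `EffectiveOperatorSupRate (potTower v) ε r`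
FAILS — so the coherence hypothesis `Reg336` of `ne2PlusUnit_kingV` cannot be dropped (with it, part 8b derives the letter at rate `L^{−1∕2}`).
[cite: Balaban1985BackgroundPropagators, (3.35)–(3.36) p.396 (the two slots: typing template); King1986, (2.13)–(2.14) p.653, (4.5) p.670 (A = 0 model)] -/
theorem potBg_reg336_not_idle (hL : 2 ≤ L) {a m2 : ℝ} (ha : 0 < a) (hm : 0 < m2) (s : ℝ)
    (U : Fin (d + 1) → ℕ) [∀ μ, NeZero (U μ)] {c35 α₀ : ℝ} (hc : 0 < c35) (hα : 0 < α₀) (ε : ℝ) {r : ℝ} (hr0 : 0 ≤ r)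
    (hr1 : r < 1) :
    ∃ v : (potBg (d := d) L s U).Cfg, (potBg (d := d) L s U).Reg335 c35 α₀ v ∧
      ¬ EffectiveOperatorSupRate (potTower L U a m2 v) ε r :=
  potTower_supRate_false_without_coherence L hL ha hm U (mul_pos hc hα) ε hr0 hr1

end Tight

end Summit.QuantumFields.YangMills.BalabanUVNodes.N15.KingModel

end
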